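import Mathlib.Algebra.Lie.Sl2
import Mathlib.Algebra.Lie.OfAssociative
import Mathlib.LinearAlgebra.FiniteDimensional.Defs
import HarnessLib

/-!
# Uniqueness of the second nil-element of an `𝔰𝔩₂`-triple

Topic `Algebra/Lie`.  Looijenga–Lunts (Invent. Math. 129 (1997), §1 p. 4, on graded Lefschetz
modules): "According to the Jacobson–Morozov lemma [the Lefschetz property of `e`] is equivalent to
the existence of [a] `K`-linear transformation `f` in `M` of degree `-2` such that `[e, f] = h`.
This `f` is then unique and `(e, h, f)` is a `sl(2)`-triple."  The uniqueness half is the classical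
fact (Bourbaki, *Lie*, Ch. VIII §11 no. 1, Lemme 1; Kostant 1959) that in an `𝔰𝔩₂`-triple
`(h, e, f)` of a finite-dimensional Lie algebra in characteristic `0`, `f` is determined by `(h, e)`:
if `(h, e, f)` and `(h, e, f')` are both `𝔰𝔩₂`-triples then `d = f - f'` satisfies `[e, d] = 0`,
`[h, d] = -2d`, so `d` would be a primitive (highest-weight) vector of weight `-2` for the adjoint
action of the triple — impossible in a finite-dimensional (Noetherian, torsion-free) module in
characteristic `0`, where primitive weights are natural numbers (Mathlib
`IsSl2Triple.HasPrimitiveVectorWith.exists_nat`).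

Used by `AlgebraicGeometry/Hyperkaehler` (dual Lefschetz operators `Λ_a` of the LLV algebra are
unique; hence commute with every graded ring automorphism fixing `a`, and restrict to invariant
sub-rings).

## Contents
* `f_eq_of_isSl2Triple` — `IsSl2Triple h e f → IsSl2Triple h e f' → f = f'` in a Lie algebra `L`
  which is Noetherian and torsion-free as a module over a characteristic-zero domain `R`;
* `e_eq_of_isSl2Triple` — the symmetric statement for `e` (via `IsSl2Triple.symm`);
* `Module.End` corollary `dualPartner_unique`: for `V` finite-dimensional over a field of
  characteristic `0`, an endomorphism `e` and a candidate `h` have at most one `𝔰𝔩₂`-partner `f` in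
  `gl(V)` (commutator bracket).
-/

namespace Literature.Algebra.Lie

open IsSl2Triple

section General

variable {R L : Type*} [CommRing R] [LieRing L] [LieAlgebra R L]

/-- **Uniqueness of `f` in an `𝔰𝔩₂`-triple `(h, e, f)`** (Looijenga–Lunts 1997 §1: "This `f` is then
unique"; Bourbaki Lie VIII §11 no. 1 Lemme 1): in a Lie algebra which is Noetherian and torsion-free
over a characteristic-zero domain (e.g. finite-dimensional over a field of characteristic `0`), two
`𝔰𝔩₂`-triples with the same `h` and `e` have the same `f`.  Proof: `f - f'` would be a primitive
vector of weight `-2` for the adjoint action. [cite: LooijengaLunts1997, §1 p. 4] -/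
theorem f_eq_of_isSl2Triple [IsDomain R] [CharZero R] [IsNoetherian R L] [Module.IsTorsionFree R L]
    {h e f f' : L} (t : IsSl2Triple h e f) (t' : IsSl2Triple h e f') : f = f' := by
  by_contra hne
  have hd : f - f' ≠ 0 := sub_ne_zero.mpr hne
  have P : t.HasPrimitiveVectorWith (f - f') (-2 : R) :=
    { ne_zero := hd
      lie_h := by
        rw [lie_sub, t.lie_lie_smul_f R, t'.lie_lie_smul_f R, smul_sub, neg_smul, neg_smul]
      lie_e := by rw [lie_sub, t.lie_e_f, t'.lie_e_f, sub_self] }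
  obtain ⟨n, hn⟩ := P.exists_nat
  have h2 : ((n + 2 : ℕ) : R) = 0 := by
    push_cast
    rw [← hn]
    ring
  exact absurd (Nat.cast_eq_zero.mp h2) (by omega)

/-- **Uniqueness of `e` in an `𝔰𝔩₂`-triple `(h, e, f)`**, the mirror statement (apply
`f_eq_of_isSl2Triple` to the triples `(-h, f, e)`, `(-h, f, e')`). [cite: LooijengaLunts1997, §1 p. 4] -/
theorem e_eq_of_isSl2Triple [IsDomain R] [CharZero R] [IsNoetherian R L] [Module.IsTorsionFree R L]
    {h e e' f : L} (t : IsSl2Triple h e f) (t' : IsSl2Triple h e' f) : e = e' :=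
  f_eq_of_isSl2Triple (R := R) t.symm t'.symm

end General

section End

-- commutator bracket on `gl(V) = Module.End K V` (Mathlib's local-instance idiom)
attribute [local instance 100] LieRing.ofAssociativeRing

variable {K : Type*} [Field K] [CharZero K] {V : Type*} [AddCommGroup V] [Module K V]
  [FiniteDimensional K V]

/-- **Dual partners in `gl(V)` are unique**: for `V` finite-dimensional over a field of
characteristic `0` and endomorphisms `h, e` of `V`, there is at most one `f ∈ gl(V)` making
`(h, e, f)` an `𝔰𝔩₂`-triple for the commutator bracket (the case of Looijenga–Lunts' Lefschetz
modules: the dual Lefschetz operator `f_a = Λ_a` of `e_a = L_a` is unique).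
[cite: LooijengaLunts1997, §1 p. 4] -/
theorem dualPartner_unique {h e f f' : Module.End K V} (t : IsSl2Triple h e f)
    (t' : IsSl2Triple h e f') : f = f' :=
  f_eq_of_isSl2Triple (R := K) t t'

end End

end Literature.Algebra.Lie
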